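import Summits.NavierStokesRegularity.NavierStokesRegularity.Theorems.PerpetualPumpThesisEnvelopeUpgradeBlock
import Summits.NavierStokesRegularity.NavierStokesRegularity.Theorems.PerpetualPumpThesisBesovFloorBoundEmbed

/-!
# Stub K2 (`envelopeUpgrade`) of line `SketchIdeator2` for `PerpetualPump.Thesis`: the envelope upgrade

Final file of the stub `envelopeUpgrade` (card K2 of the idea `besov-envelope-floor`, crux
stmt-NavierStokesRegularity-1832), proving the registered statement `stub_envelopeUpgrade`: for every
averaging datum `𝒜` of Tao's averaged Navier–Stokes equation (T. Tao, J. Amer. Math. Soc. 29 (2016),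
(1.12)–(1.15)), every Schwartz divergence-free datum and every `H¹⁰_df`-mild solution `u` on `[0,T)`,
an `L^∞` Type-I bound `‖u(t)‖_{L^∞} ≤ M (T-t)^{-1/2}` forces a Type-I bound of the Besov envelope,

  `√(T-t) ‖u(t)‖_{Ḃ⁰_{∞,1}} ≤ M'`  for all `t ∈ [0,T)`.

Neither the symmetry nor the cancellation of `𝒜` is used: the upgrade is a parabolic regularity
statement ("no log-hot stack below the front"), not an energy statement.

## Proof (the census closes by a square-root gain)

Write `N(s) = (T-s)^{-1/2}`, `X(s) = ‖u(s)‖_{Ḃ⁰_{∞,1}} = ∑_k ‖Δ̇_k u(s)‖_∞`. The round inequality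
(`K2.exists_round_le`, from the blockwise bounds of part II) shows: if `X(s) ≤ A N(s)` on `[0,t]` then
`X(t') ≤ C_H X(0) + K_R M^{3/4} A^{1/2} N(t')` for every `t' ≤ t` — each block of the Duhamel term is
`≲ A² N` times a two-sided decaying profile in `k` centred at the front `2ᵏ ∼ N` (the blockwise
estimate of stub F_A integrated against the singular weight `(T-s)^{-1}`), each block is also capped
by `2‖Ṡ‖ M N` (the `L^∞` rate), and the geometric mean of cap and profile is summable in `k` with
total `≲ M^{3/4} A^{1/2} N`. Here (`K2.envelope_typeI`): for fixed `t < T` the amplitude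
`ρ(s) = √(T-s) X(s)` is bounded on `[0,t]` (`u ∈ C_t H¹⁰`, `H¹⁰ ⊂ Ḃ⁰_{∞,1}`); its supremum `S`
is an admissible `A`, so the round inequality gives `S ≤ α + β √S` with `α = C_H X(0) √T`,
`β = K_R M^{3/4}` independent of `t`, whence `S ≤ 2α + β²`.

## References

* T. Tao, J. Amer. Math. Soc. 29 (2016), 601–674, §1.1 (1.15), p. 8.
* H. Bahouri, J.-Y. Chemin, R. Danchin, *Fourier Analysis and Nonlinear PDE* (2011), §2.1–2.2.
-/

noncomputable section

open MeasureTheory Filter Topology Set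
open scoped SchwartzMap ENNReal NNReal

set_option linter.dupNamespace false

namespace Summit.NavierStokesRegularity.NavierStokesRegularity.Theorems.PerpetualPumpThesis.K2

open Literature.Analysis.FunctionSpaces Literature.Analysis.FluidPDE
  Literature.Analysis.FluidPDE.Tao2016

/-! ### The round inequality of the census -/

/-- **The round inequality of the census.** For every averaging datum `𝒜` there are `C_H` and
`K_R ≥ 0` such that: if `u` is a mild `H¹⁰_df` solution on `[0,T)`, `0 ≤ t < T`, `M, A ≥ 0`,
`‖u(t)‖_{L^∞} ≤ M (T-t)^{-1/2}` and `‖u(s)‖_{Ḃ⁰_{∞,1}} ≤ A (T-s)^{-1/2}` for all `s ∈ [0,t]`, then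
`‖u(t)‖_{Ḃ⁰_{∞,1}} ≤ C_H ‖u(0)‖_{Ḃ⁰_{∞,1}} + K_R M^{3/4} A^{1/2} (T-t)^{-1/2}`. -/
theorem exists_round_le (𝒜 : AveragingDatum) :
    ∃ (CH : ℝ≥0) (KR : ℝ), 0 ≤ KR ∧ ∀ (a : L2C) (T : ℝ) (u : ℝ → L2C),
      IsMildSolutionFor 𝒜.form a (Ico 0 T) u → ∀ (M A t : ℝ), 0 ≤ M → 0 ≤ A → 0 ≤ t → t < T →
      eLpNorm (u t : EuclideanSpace ℝ (Fin 3) → EuclideanSpace ℂ (Fin 3)) ⊤ volume ≤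
        ENNReal.ofReal (M / Real.sqrt (T - t)) →
      (∀ s ∈ Icc 0 t, eHomBesovNorm 0 ∞ 1
        ((u s : L2C) : 𝓢'(EuclideanSpace ℝ (Fin 3), EuclideanSpace ℂ (Fin 3))) ≤
          ENNReal.ofReal (A / Real.sqrt (T - s))) →
      eHomBesovNorm 0 ∞ 1 ((u t : L2C) : 𝓢'(EuclideanSpace ℝ (Fin 3), EuclideanSpace ℂ (Fin 3))) ≤
        CH * eHomBesovNorm 0 ∞ 1
            ((u 0 : L2C) : 𝓢'(EuclideanSpace ℝ (Fin 3), EuclideanSpace ℂ (Fin 3))) +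
          ENNReal.ofReal (KR * M ^ (3 / 4 : ℝ) * Real.sqrt A / Real.sqrt (T - t)) := by
  obtain ⟨CH, hCH⟩ := FA.exists_eHomBesovNorm_coe_heat_le
  obtain ⟨K, hKfin, hK⟩ := exists_duhamel_block_majorant 𝒜
  -- constants
  set lam : ℝ := (2 : ℝ) ^ (1 / 8 : ℝ) with hlam
  have hlam1 : 1 < lam := Real.one_lt_rpow one_lt_two (by norm_num)
  set Ct : ℝ≥0∞ := 2 * (1 - ENNReal.ofReal lam⁻¹)⁻¹ with hCt
  have hCtfin : Ct ≠ ⊤ := (tent_const_lt_top hlam1).ne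
  set L₀ : ℝ := (lowFreqOpNormBound (EuclideanSpace ℝ (Fin 3))).toReal with hL₀
  have hL₀' : lowFreqOpNormBound (EuclideanSpace ℝ (Fin 3)) = ENNReal.ofReal L₀ :=
    (ENNReal.ofReal_toReal lowFreqOpNormBound_lt_top.ne).symm
  have hL₀0 : 0 ≤ L₀ := ENNReal.toReal_nonneg
  set CΓ : ℝ := max (Real.pi ^ 2 / 8)⁻¹ (Real.Gamma (1 / 4) * (Real.pi ^ 2 / 8) ^ (-(1 / 4 : ℝ)))
    with hCΓ
  have hCΓ0 : 0 ≤ CΓ := le_max_of_le_left (inv_nonneg.2 (by positivity))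
  set Cq : ℝ := 3 * K.toReal * CΓ with hCq
  have hCq0 : 0 ≤ Cq := by positivity
  set KR : ℝ := Ct.toReal * ((2 * L₀) ^ (3 / 4 : ℝ) * Cq ^ (1 / 4 : ℝ)) with hKR
  have hKR0 : 0 ≤ KR := by positivity
  refine ⟨CH, KR, hKR0, fun a T u hu M A t hM hA ht0 htT hrate hmaj => ?_⟩
  -- notation
  set D : ℝ := T - t with hD
  have hDpos : 0 < D := sub_pos.2 htT
  have hsD : 0 < Real.sqrt D := Real.sqrt_pos.2 hDpos
  set N : ℝ := (Real.sqrt D)⁻¹ with hN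
  have hN0 : 0 ≤ N := inv_nonneg.2 hsD.le
  set aM : ℝ := 2 * L₀ * M with haM
  have haM0 : 0 ≤ aM := by positivity
  set r : ℝ := (Real.sqrt D) ^ (1 / 8 : ℝ) with hr
  have hr0 : 0 < r := Real.rpow_pos_of_pos hsD _
  -- the tent variable of block `k`
  have hm : ∀ k : ℤ, min (((2 : ℝ) ^ k * Real.sqrt D) ^ (1 / 8 : ℝ))
      (((2 : ℝ) ^ k * Real.sqrt D) ^ (1 / 8 : ℝ))⁻¹ = min (lam ^ k * r) (lam ^ k * r)⁻¹ := by
    intro k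
    rw [rpow_eighth_eq k D]
  have hm0 : ∀ k : ℤ, 0 ≤ min (lam ^ k * r) (lam ^ k * r)⁻¹ := fun k =>
    le_min (mul_nonneg (zpow_pos (one_pos.trans hlam1) k).le hr0.le)
      (inv_nonneg.2 (mul_nonneg (zpow_pos (one_pos.trans hlam1) k).le hr0.le))
  -- the splitting `u(t) = e^{tΔ}u(0) + D(t)`
  have ht0I : (0 : ℝ) ∈ Ico 0 T := ⟨le_rfl, ht0.trans_lt htT⟩
  have hsplit : ((u t : L2C) : 𝓢'(EuclideanSpace ℝ (Fin 3), EuclideanSpace ℂ (Fin 3))) =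
      ((heat (t - 0) (u 0) : L2C) : 𝓢'(EuclideanSpace ℝ (Fin 3), EuclideanSpace ℂ (Fin 3))) +
        ((u t - heat (t - 0) (u 0) : L2C) : 𝓢'(EuclideanSpace ℝ (Fin 3), EuclideanSpace ℂ (Fin 3))) := by
    rw [← coe_add_Lp, add_sub_cancel]
  -- blockwise: the cap
  have hcap : ∀ k : ℤ, eLpNormDistrib ∞ (lpBlock k ((u t : L2C) :
      𝓢'(EuclideanSpace ℝ (Fin 3), EuclideanSpace ℂ (Fin 3)))) ≤ ENNReal.ofReal (aM * N) := by
    intro k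
    refine (block_le_eLpNorm (u t) k).trans ?_
    rw [hL₀', haM, hN, ← div_eq_mul_inv, mul_div_assoc, ENNReal.ofReal_mul (by positivity),
      ENNReal.ofReal_mul zero_le_two, ENNReal.ofReal_ofNat]
    gcongr
  -- blockwise: heat part plus the Duhamel tent
  have hduh : ∀ k : ℤ, eLpNormDistrib ∞ (lpBlock k ((u t : L2C) :
      𝓢'(EuclideanSpace ℝ (Fin 3), EuclideanSpace ℂ (Fin 3)))) ≤
      eLpNormDistrib ∞ (lpBlock k ((heat (t - 0) (u 0) : L2C) :
        𝓢'(EuclideanSpace ℝ (Fin 3), EuclideanSpace ℂ (Fin 3)))) +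
      ENNReal.ofReal (Cq * A ^ 2 * N * (min (lam ^ k * r) (lam ^ k * r)⁻¹) ^ 4) := by
    intro k
    rw [hsplit, map_add]
    refine (eLpNormDistrib_add_le _ _).trans (add_le_add le_rfl ?_)
    refine (hK a T u hu (fun s => ENNReal.ofReal (A / Real.sqrt (T - s))) 0 t le_rfl ht0 htT
      hmaj k).trans ?_
    refine (duhamel_integral_le_tent hKfin hA htT 0 k).trans (le_of_eq ?_)
    rw [hm k, hCq]
    congr 1
    ring
  -- blockwise: the geometric mean
  have hblock : ∀ k : ℤ, eLpNormDistrib ∞ (lpBlock k ((u t : L2C) :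
      𝓢'(EuclideanSpace ℝ (Fin 3), EuclideanSpace ℂ (Fin 3)))) ≤
      eLpNormDistrib ∞ (lpBlock k ((heat (t - 0) (u 0) : L2C) :
        𝓢'(EuclideanSpace ℝ (Fin 3), EuclideanSpace ℂ (Fin 3)))) +
      ENNReal.ofReal (aM ^ (3 / 4 : ℝ) * (Cq * A ^ 2) ^ (1 / 4 : ℝ) * N) *
        ENNReal.ofReal (min (lam ^ k * r) (lam ^ k * r)⁻¹) := by
    intro k
    refine (le_add_min (hcap k) (hduh k)).trans ?_
    rw [← ENNReal.ofReal_mono.map_min, ← ENNReal.ofReal_mul (by positivity)]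
    gcongr
    refine (min_le_rpow_mul_rpow (by positivity) (by positivity)).trans (le_of_eq ?_)
    rw [show Cq * A ^ 2 * N * min (lam ^ k * r) (lam ^ k * r)⁻¹ ^ 4 =
        Cq * A ^ 2 * N * (min (lam ^ k * r) (lam ^ k * r)⁻¹) ^ 4 from rfl,
      gm_profile haM0 (by positivity) hN0 (hm0 k)]
  -- sum over the blocks
  have hheat : eHomBesovNorm 0 ∞ 1 ((heat (t - 0) (u 0) : L2C) :
      𝓢'(EuclideanSpace ℝ (Fin 3), EuclideanSpace ℂ (Fin 3))) ≤
      CH * eHomBesovNorm 0 ∞ 1 ((u 0 : L2C) : 𝓢'(EuclideanSpace ℝ (Fin 3), EuclideanSpace ℂ (Fin 3))) :=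
    hCH (t - 0) (by linarith) (u 0)
  have htent : ∑' k : ℤ, ENNReal.ofReal (min (lam ^ k * r) (lam ^ k * r)⁻¹) ≤ Ct :=
    tsum_tent_le hlam1 hr0
  have hβ : ENNReal.ofReal (aM ^ (3 / 4 : ℝ) * (Cq * A ^ 2) ^ (1 / 4 : ℝ) * N) * Ct =
      ENNReal.ofReal (KR * M ^ (3 / 4 : ℝ) * Real.sqrt A / Real.sqrt (T - t)) := by
    rw [← ENNReal.ofReal_toReal hCtfin, ← ENNReal.ofReal_mul' ENNReal.toReal_nonneg]
    congr 1
    have hA4 : (A ^ 2) ^ (1 / 4 : ℝ) = Real.sqrt A := by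
      rw [← Real.rpow_natCast A 2, ← Real.rpow_mul hA, Real.sqrt_eq_rpow]
      norm_num
    rw [haM, Real.mul_rpow (by positivity) hM, Real.mul_rpow hCq0 (sq_nonneg A), hA4, hKR, hN, hD]
    ring
  calc eHomBesovNorm 0 ∞ 1 ((u t : L2C) : 𝓢'(EuclideanSpace ℝ (Fin 3), EuclideanSpace ℂ (Fin 3)))
      = ∑' k : ℤ, eLpNormDistrib ∞ (lpBlock k ((u t : L2C) :
          𝓢'(EuclideanSpace ℝ (Fin 3), EuclideanSpace ℂ (Fin 3)))) := eHomBesovNorm_zero_one_eq_tsum _ _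
    _ ≤ ∑' k : ℤ, (eLpNormDistrib ∞ (lpBlock k ((heat (t - 0) (u 0) : L2C) :
          𝓢'(EuclideanSpace ℝ (Fin 3), EuclideanSpace ℂ (Fin 3)))) +
        ENNReal.ofReal (aM ^ (3 / 4 : ℝ) * (Cq * A ^ 2) ^ (1 / 4 : ℝ) * N) *
          ENNReal.ofReal (min (lam ^ k * r) (lam ^ k * r)⁻¹)) := ENNReal.tsum_le_tsum hblock
    _ = eHomBesovNorm 0 ∞ 1 ((heat (t - 0) (u 0) : L2C) :
          𝓢'(EuclideanSpace ℝ (Fin 3), EuclideanSpace ℂ (Fin 3))) +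
        ENNReal.ofReal (aM ^ (3 / 4 : ℝ) * (Cq * A ^ 2) ^ (1 / 4 : ℝ) * N) *
          ∑' k : ℤ, ENNReal.ofReal (min (lam ^ k * r) (lam ^ k * r)⁻¹) := by
        rw [ENNReal.tsum_add, ENNReal.tsum_mul_left, eHomBesovNorm_zero_one_eq_tsum]
    _ ≤ CH * eHomBesovNorm 0 ∞ 1 ((u 0 : L2C) : 𝓢'(EuclideanSpace ℝ (Fin 3), EuclideanSpace ℂ (Fin 3))) +
        ENNReal.ofReal (aM ^ (3 / 4 : ℝ) * (Cq * A ^ 2) ^ (1 / 4 : ℝ) * N) * Ct :=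
        add_le_add hheat (mul_le_mul' le_rfl htent)
    _ = _ := by rw [hβ]

/-! ### The supremum argument -/

/-- `S ≤ α + β √S` with `S, α, β ≥ 0` forces `S ≤ 2α + β²`. -/
theorem le_of_le_add_mul_sqrt {S α β : ℝ} (hS : 0 ≤ S) (h : S ≤ α + β * Real.sqrt S) :
    S ≤ 2 * α + β ^ 2 := by
  nlinarith [Real.sq_sqrt hS, Real.sqrt_nonneg S, sq_nonneg (Real.sqrt S - β)]

/-- **The envelope upgrade along a mild solution with the `L^∞` Type-I rate** (the mathematics of
`stub_envelopeUpgrade`, for an arbitrary averaging datum and an arbitrary datum class `a`): if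
`‖u(t)‖_{L^∞} ≤ M (T-t)^{-1/2}` on `[0,T)` (`M ≥ 0`) then `√(T-t) ‖u(t)‖_{Ḃ⁰_{∞,1}} ≤ M'` on `[0,T)`
for some `M'` (supremum argument on the round inequality of part II). -/
theorem envelope_typeI (𝒜 : AveragingDatum) (a : L2C) (T : ℝ) (u : ℝ → L2C)
    (hu : IsMildSolutionFor 𝒜.form a (Ico 0 T) u) (M : ℝ) (hM : 0 ≤ M)
    (hrate : ∀ t ∈ Ico 0 T,
      eLpNorm (u t : EuclideanSpace ℝ (Fin 3) → EuclideanSpace ℂ (Fin 3)) ⊤ volume ≤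
        ENNReal.ofReal (M / Real.sqrt (T - t))) :
    ∃ M' : ℝ, ∀ t ∈ Ico 0 T, ENNReal.ofReal (Real.sqrt (T - t)) *
      eHomBesovNorm 0 ∞ 1 ((u t : L2C) : 𝓢'(EuclideanSpace ℝ (Fin 3), EuclideanSpace ℂ (Fin 3))) ≤
        ENNReal.ofReal M' := by
  obtain ⟨CH, KR, hKR0, hround⟩ := exists_round_le 𝒜
  obtain ⟨CF, hCF⟩ := F.exists_eHomBesovNorm_le_H10
  -- the `t`-independent constants
  set X0 : ℝ≥0∞ := eHomBesovNorm 0 ∞ 1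
    ((u 0 : L2C) : 𝓢'(EuclideanSpace ℝ (Fin 3), EuclideanSpace ℂ (Fin 3))) with hX0
  set α : ℝ := ((CH : ℝ≥0∞) * X0).toReal * Real.sqrt T with hα
  set β : ℝ := KR * M ^ (3 / 4 : ℝ) with hβ
  refine ⟨2 * α + β ^ 2, fun t ht => ?_⟩
  have hT : 0 < T := ht.1.trans_lt ht.2
  -- finiteness of the envelope on `[0,t]`
  have hfinH : ∀ s ∈ Icc 0 t, eFourierSobolevNorm 10 (u s) < ⊤ := fun s hs =>
    (hu.1 s ⟨hs.1, hs.2.trans_lt ht.2⟩).1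
  obtain ⟨R, hR⟩ := (hu.2.1.mono (Icc_subset_Ico_right ht.2)).exists_bound hfinH
  have h0I : (0 : ℝ) ∈ Icc 0 t := ⟨le_rfl, ht.1⟩
  have hR0 : 0 ≤ R := ENNReal.toReal_nonneg.trans (hR 0 h0I)
  have hXle : ∀ s ∈ Icc 0 t, eHomBesovNorm 0 ∞ 1
      ((u s : L2C) : 𝓢'(EuclideanSpace ℝ (Fin 3), EuclideanSpace ℂ (Fin 3))) ≤
      ENNReal.ofReal (CF * R) := by
    intro s hs
    refine (hCF (u s)).trans ?_
    rw [ENNReal.ofReal_mul CF.coe_nonneg, ENNReal.ofReal_coe_nnreal,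
      ← ENNReal.ofReal_toReal (hfinH s hs).ne]
    gcongr
    exact hR s hs
  have hXfin : ∀ s ∈ Icc 0 t, eHomBesovNorm 0 ∞ 1
      ((u s : L2C) : 𝓢'(EuclideanSpace ℝ (Fin 3), EuclideanSpace ℂ (Fin 3))) ≠ ⊤ := fun s hs =>
    ((hXle s hs).trans_lt ENNReal.ofReal_lt_top).ne
  have hX0fin : X0 ≠ ⊤ := hXfin 0 ⟨le_rfl, ht.1⟩
  have hCX0fin : (CH : ℝ≥0∞) * X0 ≠ ⊤ := ENNReal.mul_ne_top ENNReal.coe_ne_top hX0fin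
  -- the amplitude `ρ(s) = √(T-s) X(s)` and its supremum on `[0,t]`
  set ρ : ℝ → ℝ := fun s => (eHomBesovNorm 0 ∞ 1
    ((u s : L2C) : 𝓢'(EuclideanSpace ℝ (Fin 3), EuclideanSpace ℂ (Fin 3)))).toReal *
      Real.sqrt (T - s) with hρ
  have hρ0 : ∀ s, 0 ≤ ρ s := fun s => mul_nonneg ENNReal.toReal_nonneg (Real.sqrt_nonneg _)
  have hρbd : ∀ s ∈ Icc 0 t, ρ s ≤ CF * R * Real.sqrt T := by
    intro s hs
    have h1 : (eHomBesovNorm 0 ∞ 1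
        ((u s : L2C) : 𝓢'(EuclideanSpace ℝ (Fin 3), EuclideanSpace ℂ (Fin 3)))).toReal ≤ CF * R := by
      have h := ENNReal.toReal_mono ENNReal.ofReal_ne_top (hXle s hs)
      rwa [ENNReal.toReal_ofReal (by positivity)] at h
    have h2 : Real.sqrt (T - s) ≤ Real.sqrt T := Real.sqrt_le_sqrt (by linarith [hs.1])
    exact mul_le_mul h1 h2 (Real.sqrt_nonneg _) (ENNReal.toReal_nonneg.trans h1)
  set S : ℝ := sSup (ρ '' Icc 0 t) with hS
  have hbdd : BddAbove (ρ '' Icc 0 t) :=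
    ⟨CF * R * Real.sqrt T, by rintro _ ⟨s, hs, rfl⟩; exact hρbd s hs⟩
  have hne : (ρ '' Icc 0 t).Nonempty := ⟨ρ 0, 0, h0I, rfl⟩
  have hρS : ∀ s ∈ Icc 0 t, ρ s ≤ S := fun s hs => le_csSup hbdd ⟨s, hs, rfl⟩
  have hS0 : 0 ≤ S := (hρ0 0).trans (hρS 0 h0I)
  -- `S` is an admissible majorant constant on `[0,t]`
  have hmaj : ∀ s ∈ Icc 0 t, eHomBesovNorm 0 ∞ 1
      ((u s : L2C) : 𝓢'(EuclideanSpace ℝ (Fin 3), EuclideanSpace ℂ (Fin 3))) ≤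
      ENNReal.ofReal (S / Real.sqrt (T - s)) := by
    intro s hs
    have hTs : 0 < Real.sqrt (T - s) := Real.sqrt_pos.2 (by linarith [hs.2, ht.2])
    rw [← ENNReal.ofReal_toReal (hXfin s hs)]
    refine ENNReal.ofReal_le_ofReal ?_
    rw [le_div_iff₀ hTs]
    exact hρS s hs
  -- the round inequality at every `t' ∈ [0,t]`
  have hρle : ∀ t' ∈ Icc 0 t, ρ t' ≤ α + β * Real.sqrt S := by
    intro t' ht'
    have ht'T : t' < T := ht'.2.trans_lt ht.2
    have hTt' : 0 < Real.sqrt (T - t') := Real.sqrt_pos.2 (sub_pos.2 ht'T)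
    have hr := hround a T u hu M S t' hM hS0 ht'.1 ht'T (hrate t' ⟨ht'.1, ht'T⟩)
      (fun s hs => hmaj s ⟨hs.1, hs.2.trans ht'.2⟩)
    have hq0 : 0 ≤ KR * M ^ (3 / 4 : ℝ) * Real.sqrt S / Real.sqrt (T - t') := by positivity
    have h := ENNReal.toReal_mono (ENNReal.add_ne_top.2 ⟨hCX0fin, ENNReal.ofReal_ne_top⟩) hr
    rw [ENNReal.toReal_add hCX0fin ENNReal.ofReal_ne_top, ENNReal.toReal_ofReal hq0] at h
    have hsqrt : Real.sqrt (T - t') ≤ Real.sqrt T := Real.sqrt_le_sqrt (by linarith [ht'.1])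
    calc ρ t' = (eHomBesovNorm 0 ∞ 1
          ((u t' : L2C) : 𝓢'(EuclideanSpace ℝ (Fin 3), EuclideanSpace ℂ (Fin 3)))).toReal *
          Real.sqrt (T - t') := rfl
      _ ≤ (((CH : ℝ≥0∞) * X0).toReal + KR * M ^ (3 / 4 : ℝ) * Real.sqrt S / Real.sqrt (T - t')) *
          Real.sqrt (T - t') := mul_le_mul_of_nonneg_right h hTt'.le
      _ = ((CH : ℝ≥0∞) * X0).toReal * Real.sqrt (T - t') + KR * M ^ (3 / 4 : ℝ) * Real.sqrt S := by
          field_simp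
      _ ≤ ((CH : ℝ≥0∞) * X0).toReal * Real.sqrt T + KR * M ^ (3 / 4 : ℝ) * Real.sqrt S := by
          gcongr
      _ = α + β * Real.sqrt S := by rw [hα, hβ]
  have hSle : S ≤ α + β * Real.sqrt S :=
    csSup_le hne (by rintro _ ⟨t', ht', rfl⟩; exact hρle t' ht')
  have hSbound : S ≤ 2 * α + β ^ 2 := le_of_le_add_mul_sqrt hS0 hSle
  -- conclusion at `t`
  have htI : t ∈ Icc 0 t := ⟨ht.1, le_rfl⟩
  rw [← ENNReal.ofReal_toReal (hXfin t htI), ← ENNReal.ofReal_mul (Real.sqrt_nonneg _), mul_comm]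
  exact ENNReal.ofReal_le_ofReal ((hρS t htI).trans hSbound)

end Summit.NavierStokesRegularity.NavierStokesRegularity.Theorems.PerpetualPumpThesis.K2

namespace Summit.NavierStokesRegularity.NavierStokesRegularity.Theorems.PerpetualPumpThesis

open Literature.Analysis.FluidPDE Literature.Analysis.FluidPDE.Tao2016
open Literature.Analysis.FunctionSpaces

/-- Local notation for physical / frequency space `ℝ³` (as printed by the registered signature). -/
local notation "ℝ³" => EuclideanSpace ℝ (Fin 3)
/-- Local notation for the complexified range `ℂ³` (as printed by the registered signature). -/
local notation "ℂ³" => EuclideanSpace ℂ (Fin 3)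

/-- **Registered sub-goal `stub_K2_Block` of stub K2**: the round inequality of the census — along a
mild `H¹⁰_df` solution of the averaged equation of any averaging datum, the `L^∞` Type-I rate at
time `t` together with a self-similar envelope majorant `‖u(s)‖_{Ḃ⁰_{∞,1}} ≤ A (T-s)^{-1/2}` on
`[0,t]` give `‖u(t)‖_{Ḃ⁰_{∞,1}} ≤ C_H ‖u(0)‖_{Ḃ⁰_{∞,1}} + K_R M^{3/4} A^{1/2} (T-t)^{-1/2}`. -/
theorem stub_K2_Block : ∀ 𝒜 : AveragingDatum, ∃ (CH : NNReal) (KR : ℝ), 0 ≤ KR ∧ ∀ (a : L2C) (T : ℝ) (u : ℝ → L2C), IsMildSolutionFor 𝒜.form a (Ico 0 T) u → ∀ (M A t : ℝ), 0 ≤ M → 0 ≤ A → 0 ≤ t → t < T → eLpNorm (u t : EuclideanSpace ℝ (Fin 3) → EuclideanSpace ℂ (Fin 3)) ⊤ volume ≤ ENNReal.ofReal (M / Real.sqrt (T - t)) → (∀ s ∈ Icc 0 t, eHomBesovNorm 0 ⊤ 1 ((u s : L2C) : 𝓢'(EuclideanSpace ℝ (Fin 3), EuclideanSpace ℂ (Fin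 3))) ≤ ENNReal.ofReal (A / Real.sqrt (T - s))) → eHomBesovNorm 0 ⊤ 1 ((u t : L2C) : 𝓢'(EuclideanSpace ℝ (Fin 3), EuclideanSpace ℂ (Fin 3))) ≤ (CH : ENNReal) * eHomBesovNorm 0 ⊤ 1 ((u 0 : L2C) : 𝓢'(EuclideanSpace ℝ (Fin 3), EuclideanSpace ℂ (Fin 3))) + ENNReal.ofReal (KR * M ^ (3 / 4 : ℝ) * Real.sqrt A / Real.sqrt (T - t)) :=
  fun 𝒜 => K2.exists_round_le 𝒜

/-- **Stub K2 `envelopeUpgrade` of line `SketchIdeator2` for `PerpetualPump.Thesis`** (card K2,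
"envelope upgrade / no log-hot stack"): along an `H¹⁰_df`-mild solution of the averaged Navier–Stokes
equation of a symmetric cancelling averaging datum from Schwartz divergence-free data, an `L^∞`
Type-I bound `‖u(t)‖_{L^∞} ≤ M/√(T-t)` on `[0,T)` forces a Type-I bound of the Besov envelope,
`√(T-t) ‖u(t)‖_{Ḃ⁰_{∞,1}} ≤ M'` on `[0,T)`. (Proved for every averaging datum and datum class; the
symmetry, cancellation and divergence-free hypotheses are not used.) -/
theorem stub_envelopeUpgrade : ∀ 𝒜 : AveragingDatum, 𝒜.IsSymmetric → 𝒜.HasCancellation → ∀ u₀ : 𝓢(ℝ³, ℝ³), VectorCalculus.IsDivFree ⇑u₀ → ∀ T : ℝ, 0 < T → ∀ u : ℝ → L2C, 𝒜.IsMildSolution (schwartzL2 u₀) (Ico 0 T) u → (∃ M : ℝ, ∀ t ∈ Ico 0 T, eLpNorm (u t) ⊤ volume ≤ ENNReal.ofReal (M / Real.sqrt (T - t))) → ∃ M' : ℝ, ∀ t ∈ Ico 0 T, ENNReal.ofReal (Real.sqrt (T - t)) * eHomBesovNorm 0 ∞ 1 ((u t : L2C) : 𝓢'(ℝ³, ℂ³))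 ≤ ENNReal.ofReal M' := by
  intro 𝒜 _ _ u₀ _ T _ u hu hrate
  obtain ⟨M, hM⟩ := hrate
  have hu' : IsMildSolutionFor 𝒜.form (schwartzL2 u₀) (Ico 0 T) u := hu
  refine K2.envelope_typeI 𝒜 (schwartzL2 u₀) T u hu' (max M 0) (le_max_right _ _) fun t ht => ?_
  exact (hM t ht).trans (ENNReal.ofReal_le_ofReal
    (div_le_div_of_nonneg_right (le_max_left _ _) (Real.sqrt_nonneg _)))

end Summit.NavierStokesRegularity.NavierStokesRegularity.Theorems.PerpetualPumpThesis

end
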